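import Summits.CriticalPhenomena.PercolationContinuityZ3.Theorems.Transplant.PathMapCommensurable
import Summits.CriticalPhenomena.PercolationContinuityZ3.Theorems.Transplant.AutVirtuallyCyclicQuasiTransitive
import HarnessLib

/-!
# The hypothesis `p_c < 1` of Conj. 4 is a property of the ACTING GROUP: for a group `A` acting by automorphisms with a finite stabiliser,
# `p_c(Cay(A;T)) < 1 ⟹ p_c(G, t) < 1` (NO transitivity); for transitive such actions `p_c(G) < 1 ⟺ p_c(Cay(A;T)) < 1` — kernel

builds on p205010 (kernel theorem, internal audit signed; external expert review pending) — nothing in this file uses p205010; unconditional, no node.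
Lane `prim-bschramm`, seat `prim-bschramm-p4` gen 24 (PART C3 of `P4-GENERAL.md` §46).  Helper file (`--supports stmt-CriticalPhenomena-4575 --as helper`).

THE POINT.  Gens 22–23 transported each Cayley certificate to graphs by hand (`AutZSq`, `AutProduct`, `AutRank`, …).  With the rough-embedding form
of the path-map domination principle (`GraphPathMap.criticalProb_lt_one_of_lipschitz`) the transport is ONE theorem:
* **`AutPathMap.criticalProb_lt_one_of_cayley`** — `A` acting on a connected locally finite `G` by automorphisms, the stabiliser of `t` FINITE, `T` ANY
  finite subset of `A` with `p_c(Cay(A;T), a₀) < 1` ⟹ `p_c(G, t) < 1` (orbit map `a ↦ a • t`: a `T`-edge `a ∼ a s` moves `a • t` by the bounded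
  distance `d(t, s • t)`; fibres are cosets of the stabiliser).  NO transitivity, NO quasi-transitivity: every Cayley certificate of ANY subgroup of the
  automorphism group with one finite stabiliser is a certificate for the graph;
* **`AutPathMap.criticalProb_lt_one_cayley_of_graph`** — conversely, for a TRANSITIVE action with finite stabiliser: `p_c(G, v) < 1 ⟹
  p_c(Cay(A;T), a) < 1` for every finite generating `T` of `A` (the section `v ↦ a_v`, `a_v • t = v`, is a rough embedding: adjacent vertices have
  `a_v⁻¹ a_w` in the finite set of elements moving `t` next to `t`);
* **`criticalProb_lt_one_cayley_of_graph_quasiTransitive`** — the same for actions with FINITELY MANY orbits and finite stabilisers of the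
  representatives (Benjamini–Schramm's almost-transitive setting; section through the representatives, fibres `≤ |T₀|`);
* **`AutPathMap.criticalProb_lt_one_iff`** — hence for transitive finite-stabiliser actions `p_c(G, v) < 1 ⟺ p_c(Cay(A;T), a) < 1`: the hypothesis
  of Conjecture 4 for such graphs is a property of (the commensurability class of) the acting group.
[cite: LyonsPeres2016, §7.4 Thm. 7.15 and the remark following it] [cite: BenjaminiSchramm1996, §2 (almost transitive graphs); Conj. 1; Conj. 4]
-/

noncomputable section

namespace Summit.CriticalPhenomena.PercolationContinuityZ3.Theorems.Transplant

open SimpleGraph Literature.Probability.Percolation Literature.Probability.LatticeModels Literature.Barriers.CriticalPhenomena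
open scoped Classical

namespace AutPathMap

variable {V : Type} {G : SimpleGraph V} [G.LocallyFinite] {A : Type} [Group A] [MulAction A V]

/-- With a finite stabiliser at `t` and countably many vertices, the acting group is countable (`A = ⋃_v {a | a • t = v}`). [folklore] -/
theorem countable_of_stabilizer_finite [Countable V] (t : V) (hfin : (MulAction.stabilizer A t : Set A).Finite) : Countable A := by
  have huniv : (Set.univ : Set A) = ⋃ v : V, {a : A | a • t = v} := by
    ext a; simp
  have hc : (Set.univ : Set A).Countable := by
    rw [huniv]; exact Set.countable_iUnion fun v => (AutScaled.finite_movers t v hfin).countable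
  exact Set.countable_univ_iff.1 hc

/-- The movers `{a | a • t = w}` number at most `|Stab(t)|`. [folklore] -/
theorem ncard_movers_le (t w : V) (hfin : (MulAction.stabilizer A t : Set A).Finite) :
    {a : A | a • t = w}.ncard ≤ (MulAction.stabilizer A t : Set A).ncard := by
  by_cases hw : ∃ a₀ : A, a₀ • t = w
  · obtain ⟨a₀, rfl⟩ := hw
    have hsub : {a : A | a • t = a₀ • t} ⊆ (fun σ => a₀ * σ) '' (MulAction.stabilizer A t : Set A) := fun a ha =>
      ⟨a₀⁻¹ * a, by
        show a₀⁻¹ * a ∈ MulAction.stabilizer A t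
        rw [MulAction.mem_stabilizer_iff, mul_smul, show a • t = a₀ • t from ha, inv_smul_smul], by group⟩
    exact (Set.ncard_le_ncard hsub (hfin.image _)).trans (Set.ncard_image_le hfin)
  · rw [show {a : A | a • t = w} = ∅ from Set.eq_empty_of_forall_notMem fun a ha => hw ⟨a, ha⟩, Set.ncard_empty]
    exact Nat.zero_le _

/-! ## §1 From the group to the graph (no transitivity) -/

/-- **THEOREM: `p_c(Cay(A;T), a₀) < 1 ⟹ p_c(G, t) < 1`** for ANY group `A` acting on a connected locally finite graph `G` by automorphisms with the
stabiliser of `t` finite, and ANY finite `T ⊆ A` (transitivity is NOT assumed).  The orbit map `a ↦ a • t` is a rough embedding of `Cay(A;T)`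
into `G`: a `T`-edge `a ∼ a s` goes to `a • t`, `a • (s • t)` at distance `d(t, s • t) ≤ L` (translate a fixed walk by the automorphism `a`); fibres
have `≤ |Stab(t)|` points; `G` has degrees `≤ D_G` (hypothesis; automatic for transitive actions).
[cite: LyonsPeres2016, §7.4 Thm. 7.15 and the remark following it] [cite: BenjaminiSchramm1996, §2 (almost transitive graphs)] -/
theorem criticalProb_lt_one_of_cayley (hact : IsActionByAut G A) (hc : G.Connected) (t : V) (hfin : (MulAction.stabilizer A t : Set A).Finite)
    {DG : ℕ} (hDG : ∀ w, G.degree w ≤ DG) (T : Finset A) (a₀ : A) (hpc : criticalProb (mulCayley (↑T : Set A)) a₀ < 1) :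
    criticalProb G t < 1 := by
  haveI : Countable V := countable_of_connected_of_locallyFinite G hc t
  haveI : Countable A := countable_of_stabilizer_finite t hfin
  -- move the certificate to the vertex `1`
  have hpc1 : criticalProb (mulCayley (↑T : Set A)) 1 < 1 := by
    have h := criticalProb_iso (leftMulIso T a₀⁻¹) a₀
    rw [leftMulIso_apply, inv_mul_cancel] at h
    rwa [h]
  -- base walks `t ⇝ s • t` for the letters `s ∈ T ∪ T⁻¹`, and their maximal length
  set Tpm : Finset A := T ∪ T.image (·⁻¹) with hTpm
  have hwk : ∀ s : A, ∃ wk : G.Walk t (s • t), True := fun s => by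
    obtain ⟨wk⟩ := hc.preconnected t (s • t); exact ⟨wk, trivial⟩
  choose wk _ using hwk
  set L : ℕ := Tpm.sup fun s => (wk s).length with hL
  -- (1) a `T`-edge `a ∼ b` moves `a • t` to `b • t = a • (s • t)` along the translated base walk
  have hLip : ∀ a b, (mulCayley (↑T : Set A)).Adj a b → ∃ w : G.Walk (a • t) (b • t), w.length ≤ L := by
    intro a b hab
    obtain ⟨-, hs⟩ := (mulCayley_adj _ a b).1 hab
    have hsmem : a⁻¹ * b ∈ Tpm := by
      rcases hs with h | h
      · exact Finset.mem_union_left _ (Finset.mem_coe.1 h)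
      · exact Finset.mem_union_right _ (Finset.mem_image.2 ⟨b⁻¹ * a, Finset.mem_coe.1 h, by rw [mul_inv_rev, inv_inv]⟩)
    have hstart : (smulIso hact a).toHom t = a • t := by show a • t = a • t; rfl
    have hend : (smulIso hact a).toHom ((a⁻¹ * b) • t) = b • t := by
      show a • ((a⁻¹ * b) • t) = b • t; rw [← mul_smul, mul_inv_cancel_left]
    refine ⟨((wk (a⁻¹ * b)).map (smulIso hact a).toHom).copy hstart hend, ?_⟩
    rw [Walk.length_copy, Walk.length_map]
    exact Finset.le_sup (f := fun s => (wk s).length) hsmem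
  -- (2) fibres of the orbit map are cosets of the stabiliser
  have hK : ∀ w : V, ((fun a : A => a • t) ⁻¹' {w}).Finite ∧ ((fun a : A => a • t) ⁻¹' {w}).ncard ≤ (MulAction.stabilizer A t : Set A).ncard :=
    fun w => ⟨AutScaled.finite_movers t w hfin, ncard_movers_le t w hfin⟩
  have h := GraphPathMap.criticalProb_lt_one_of_lipschitz (H := mulCayley (↑T : Set A)) (G := G) (fun a : A => a • t) hLip hK
    (degree_mulCayley_le T) hDG 1 hpc1
  simpa using h

/-- **Transitive actions: the degree bound is automatic** (`deg w = deg t`), so `p_c(Cay(A;T), a₀) < 1 ⟹ p_c(G, v) < 1` at EVERY vertex.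
[cite: LyonsPeres2016, §7.4 Thm. 7.15 and the remark following it] [cite: BenjaminiSchramm1996, §2 (almost transitive graphs)] -/
theorem criticalProb_lt_one_of_cayley_transitive (hact : IsActionByAut G A) (hc : G.Connected) (t : V) (htr : ∀ v : V, ∃ a : A, a • t = v)
    (hfin : (MulAction.stabilizer A t : Set A).Finite) (T : Finset A) (a₀ : A) (hpc : criticalProb (mulCayley (↑T : Set A)) a₀ < 1) (v : V) :
    criticalProb G v < 1 := by
  haveI : Countable V := countable_of_connected_of_locallyFinite G hc t
  have hDG : ∀ w, G.degree w ≤ G.degree t := fun w => by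
    obtain ⟨a, rfl⟩ := htr w
    rw [← smulIso_apply hact a t, (smulIso hact a).degree_eq t]
  have ht : criticalProb G t < 1 := criticalProb_lt_one_of_cayley hact hc t hfin hDG T a₀ hpc
  obtain ⟨a, rfl⟩ := htr v
  rwa [← smulIso_apply hact a t, criticalProb_iso (smulIso hact a) t]

/-! ## §2 From the graph to the group (transitive actions) -/

/-- **THEOREM: `p_c(G, v) < 1 ⟹ p_c(Cay(A;T), a) < 1`** for a TRANSITIVE action with finite stabiliser and every finite generating `T` of `A`.
The section `v ↦ a_v` (`a_v • t = v`) is a rough embedding `G → Cay(A;T)`: for adjacent `v ∼ w`, `a_v⁻¹ a_w` moves `t` next to `t`, hence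
lies in a finite set, of bounded `T`-length; the section is injective. [cite: LyonsPeres2016, §7.4 Thm. 7.15 and the remark following it]
[cite: BenjaminiSchramm1996, §2 (almost transitive graphs)] -/
theorem criticalProb_lt_one_cayley_of_graph (hact : IsActionByAut G A) (hc : G.Connected) (t : V) (htr : ∀ v : V, ∃ a : A, a • t = v)
    (hfin : (MulAction.stabilizer A t : Set A).Finite) (T : Finset A) (hT : Subgroup.closure (T : Set A) = ⊤) (v : V)
    (hpc : criticalProb G v < 1) (a : A) : criticalProb (mulCayley (↑T : Set A)) a < 1 := by
  haveI : Countable V := countable_of_connected_of_locallyFinite G hc t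
  haveI : Countable A := countable_of_stabilizer_finite t hfin
  set sec : V → A := AutScaled.sec htr with hsec
  have hsec_smul : ∀ w, sec w • t = w := AutScaled.sec_smul htr
  -- the finite set of elements moving `t` next to `t`, their `T`-words, the maximal length
  have hMfin : {g : A | G.Adj t (g • t)}.Finite := AutVirtCycQT.finite_adjMovers (G := G) t t hfin
  choose wd hwd using CayleyZSq.exists_word T hT
  set L : ℕ := hMfin.toFinset.sup fun m => (wd m).length with hL
  -- (1) Lipschitz
  have hLip : ∀ x y, G.Adj x y → ∃ w : (mulCayley (↑T : Set A)).Walk (sec x) (sec y), w.length ≤ L := by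
    intro x y hxy
    set m : A := (sec x)⁻¹ * sec y with hm
    have hmM : m ∈ {g : A | G.Adj t (g • t)} := by
      show G.Adj t (m • t)
      rw [hm, mul_smul, hsec_smul y, ← hact (sec x), smul_inv_smul, hsec_smul x]
      exact hxy
    obtain ⟨w, hw⟩ := CayleyComm.exists_walk_word T (wd m) (hwd m).1 (sec x)
    have hend : sec x * (wd m).prod = sec y := by rw [(hwd m).2, hm, mul_inv_cancel_left]
    refine ⟨w.copy rfl hend, ?_⟩
    rw [Walk.length_copy, hw]
    exact Finset.le_sup (f := fun m => (wd m).length) (hMfin.mem_toFinset.2 hmM)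
  -- (2) the section is injective
  have hinj : Function.Injective sec := fun x y h => by rw [← hsec_smul x, ← hsec_smul y, h]
  have hK : ∀ b : A, (sec ⁻¹' {b}).Finite ∧ (sec ⁻¹' {b}).ncard ≤ 1 := fun b => by
    have hsub : sec ⁻¹' {b} ⊆ {b • t} := fun x hx => by
      have hx' : sec x = b := hx
      show x = b • t
      rw [← hx', hsec_smul]
    exact ⟨(Set.finite_singleton _).subset hsub, (Set.ncard_le_ncard hsub (Set.finite_singleton _)).trans (by rw [Set.ncard_singleton])⟩
  -- (3) degree bounds
  have hDH : ∀ w, G.degree w ≤ G.degree t := fun w => by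
    obtain ⟨b, rfl⟩ := htr w
    rw [← smulIso_apply hact b t, (smulIso hact b).degree_eq t]
  have h := GraphPathMap.criticalProb_lt_one_of_lipschitz (H := G) (G := mulCayley (↑T : Set A)) sec hLip hK hDH
    (degree_mulCayley_le T) v hpc
  exact CayleyPathMap.criticalProb_lt_one_of_finset T hT T (sec v) h a

/-- **QUASI-TRANSITIVE form of the converse (Benjamini–Schramm's "almost transitive" setting)**: `A` acting with FINITELY MANY orbits
(representatives `T₀`) and finite stabilisers of the representatives: `p_c(G, v) < 1 ⟹ p_c(Cay(A;T), a) < 1` for every finite generating `T`.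
(The section `v ↦ a_v`, `a_v • t_v = v` with `t_v ∈ T₀`, has fibres of size `≤ |T₀|`; for adjacent `v ∼ w`, `a_v⁻¹ a_w` moves some representative
next to some representative — a finite set.) [cite: BenjaminiSchramm1996, §2 (almost transitive graphs); Conj. 1] [cite: LyonsPeres2016, §7.4 Thm. 7.15] -/
theorem criticalProb_lt_one_cayley_of_graph_quasiTransitive (hact : IsActionByAut G A) (hc : G.Connected) (T₀ : Finset V)
    (horb : ∀ v : V, ∃ a : A, ∃ t ∈ T₀, a • t = v) (hfin : ∀ t ∈ T₀, (MulAction.stabilizer A t : Set A).Finite) (T : Finset A)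
    (hT : Subgroup.closure (T : Set A) = ⊤) (v : V) (hpc : criticalProb G v < 1) (a : A) : criticalProb (mulCayley (↑T : Set A)) a < 1 := by
  haveI : Countable V := countable_of_connected_of_locallyFinite G hc v
  obtain ⟨a₁, t₁, ht₁, -⟩ := horb v
  haveI : Countable A := countable_of_stabilizer_finite t₁ (hfin t₁ ht₁)
  -- the section
  choose sec rep hrep hsec using horb
  -- the finite set of elements moving a representative next to a representative, their `T`-words, the maximal length
  have hMfin : {g : A | ∃ t ∈ T₀, ∃ t' ∈ T₀, G.Adj t (g • t')}.Finite := by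
    refine ((T₀.finite_toSet.prod T₀.finite_toSet).biUnion fun q hq => AutVirtCycQT.finite_adjMovers G (A := A) q.1 q.2 (hfin q.2 hq.2)).subset ?_
    rintro g ⟨t, ht, t', ht', hg⟩
    exact Set.mem_biUnion (x := (t, t')) ⟨Finset.mem_coe.2 ht, Finset.mem_coe.2 ht'⟩ hg
  choose wd hwd using CayleyZSq.exists_word T hT
  set L : ℕ := hMfin.toFinset.sup fun m => (wd m).length with hL
  -- (1) Lipschitz
  have hLip : ∀ x y, G.Adj x y → ∃ w : (mulCayley (↑T : Set A)).Walk (sec x) (sec y), w.length ≤ L := by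
    intro x y hxy
    set m : A := (sec x)⁻¹ * sec y with hm
    have hmM : m ∈ {g : A | ∃ t ∈ T₀, ∃ t' ∈ T₀, G.Adj t (g • t')} := by
      refine ⟨rep x, hrep x, rep y, hrep y, ?_⟩
      rw [hm, mul_smul, hsec y, ← hact (sec x), smul_inv_smul, hsec x]
      exact hxy
    obtain ⟨w, hw⟩ := CayleyComm.exists_walk_word T (wd m) (hwd m).1 (sec x)
    have hend : sec x * (wd m).prod = sec y := by rw [(hwd m).2, hm, mul_inv_cancel_left]
    refine ⟨w.copy rfl hend, ?_⟩
    rw [Walk.length_copy, hw]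
    exact Finset.le_sup (f := fun m => (wd m).length) (hMfin.mem_toFinset.2 hmM)
  -- (2) fibres of the section: `x = sec x • rep x` with `rep x ∈ T₀`
  have hK : ∀ b : A, (sec ⁻¹' {b}).Finite ∧ (sec ⁻¹' {b}).ncard ≤ T₀.card := fun b => by
    have hsub : sec ⁻¹' {b} ⊆ ↑(T₀.image fun t => b • t) := fun x hx => by
      have hx' : sec x = b := hx
      rw [Finset.coe_image]
      exact ⟨rep x, Finset.mem_coe.2 (hrep x), by show b • rep x = x; rw [← hx', hsec]⟩
    exact ⟨(Finset.finite_toSet _).subset hsub,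
      (Set.ncard_le_ncard hsub (Finset.finite_toSet _)).trans (by rw [Set.ncard_coe_finset]; exact Finset.card_image_le)⟩
  -- (3) degree bound on `G` (finitely many orbits)
  have hDH : ∀ w, G.degree w ≤ T₀.sup fun t => G.degree t := fun w => by
    rw [← hsec w, ← smulIso_apply hact (sec w) (rep w), (smulIso hact (sec w)).degree_eq (rep w)]
    exact Finset.le_sup (f := fun t => G.degree t) (hrep w)
  have h := GraphPathMap.criticalProb_lt_one_of_lipschitz (H := G) (G := mulCayley (↑T : Set A)) sec hLip hK hDH
    (degree_mulCayley_le T) v hpc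
  exact CayleyPathMap.criticalProb_lt_one_of_finset T hT T (sec v) h a

/-- **COROLLARY: for a transitive finite-stabiliser action, `p_c(G, v) < 1 ⟺ p_c(Cay(A;T), a) < 1`** (every finite generating `T`, every `v`, `a`):
the hypothesis of Conjecture 4 is a property of the acting group. [cite: BenjaminiSchramm1996, §2 Conj. 1; Conj. 4] [cite: LyonsPeres2016, §7.4 Thm. 7.15] -/
theorem criticalProb_lt_one_iff (hact : IsActionByAut G A) (hc : G.Connected) (t : V) (htr : ∀ v : V, ∃ a : A, a • t = v)
    (hfin : (MulAction.stabilizer A t : Set A).Finite) (T : Finset A) (hT : Subgroup.closure (T : Set A) = ⊤) (v : V) (a : A) :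
    criticalProb G v < 1 ↔ criticalProb (mulCayley (↑T : Set A)) a < 1 :=
  ⟨fun h => criticalProb_lt_one_cayley_of_graph hact hc t htr hfin T hT v h a,
   fun h => criticalProb_lt_one_of_cayley_transitive hact hc t htr hfin T a h v⟩

end AutPathMap

end Summit.CriticalPhenomena.PercolationContinuityZ3.Theorems.Transplant

end
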